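import Mathlib
import Summits.AnomalousDissipation.AnomalousDissipation.Theorems.NegSteadyThinSetLiouville

/-!
# Classical DSS flux rigidity, part 1/4: arctan profiles and radial test functions

Support file (cdisprove seat, crux `PointSink.PointFluxCone`, stmt-AnomalousDissipation-19033) for
`Theorems/PointFluxCone/Negative/ClassicalFluxRigidity.lean`, which proves that no `C¹`-off-the-origin
discretely self-similar steady Euler pair of degrees `(−2/3, −4/3)` has non-zero shell flux.

Contents: elementary facts about the bounded profiles `c · arctan (s / c)` (`|c·arctan(s/c)| ≤ |s|`,
limits `s` as `c → ∞` and `0` as `c → 0⁺`; the derivative and the bound `c π/2` are reused from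
`ThinSetLiouville`), and the RADIAL TEST FUNCTIONS `x ↦ ρ(‖x‖²)` where `ρ` is the primitive of
`k(u) = (ζ(u) − ζ(u/L))/u` for a continuous profile `ζ` supported in `[a, b] ⊂ (0, ∞)` and a ratio
`L ≥ 1`: `ρ` is `C¹` and compactly supported in `(0, ∞)` because `ζ` and `ζ(·/L)` have the same
`du/u`-mass, so `ρ(‖x‖²)` is a `C¹_c` test vanishing near the origin with
`⟪W, ∇ρ(‖x‖²)⟫ = 2 k(‖x‖²) ⟪W, x⟫`. [folklore]
-/

set_option linter.dupNamespace false  -- `Summit.AnomalousDissipation.AnomalousDissipation` is the mandated summit/problem namespace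

noncomputable section

open MeasureTheory Metric Filter Topology Set Function
open scoped InnerProductSpace RealInnerProductSpace
open Literature.Analysis.FluidPDE

namespace Summit.AnomalousDissipation.AnomalousDissipation.Theorems.PointFluxCone.Negative


/-! ## Elementary facts about `c · arctan (s / c)` -/

/-- `|arctan t| ≤ |t|`. [folklore] -/
theorem abs_arctan_le_abs (t : ℝ) : |Real.arctan t| ≤ |t| := by
  have h : ∀ t : ℝ, 0 ≤ t → |Real.arctan t| ≤ |t| := by
    intro t ht
    have h0 : 0 ≤ Real.arctan t := Real.arctan_nonneg.mpr ht
    have h1 := Real.le_tan h0 (Real.arctan_lt_pi_div_two t)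
    rw [Real.tan_arctan] at h1
    rwa [abs_of_nonneg h0, abs_of_nonneg ht]
  rcases le_total 0 t with ht | ht
  · exact h t ht
  · have h1 := h (-t) (neg_nonneg.mpr ht)
    rwa [Real.arctan_neg, abs_neg, abs_neg] at h1

/-- `|c · arctan (s / c)| ≤ |s|` for `c > 0`. [folklore] -/
theorem abs_mul_arctan_div_le_abs {c : ℝ} (hc : 0 < c) (s : ℝ) :
    |c * Real.arctan (s / c)| ≤ |s| := by
  rw [abs_mul, abs_of_pos hc]
  calc c * |Real.arctan (s / c)| ≤ c * |s / c| :=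
        mul_le_mul_of_nonneg_left (abs_arctan_le_abs _) hc.le
    _ = |s| := by rw [abs_div, abs_of_pos hc]; field_simp

/-- `c · arctan (s / c) → s` as `c → +∞`. [folklore] -/
theorem tendsto_mul_arctan_div_atTop (s : ℝ) :
    Tendsto (fun c : ℝ => c * Real.arctan (s / c)) atTop (𝓝 s) := by
  rcases eq_or_ne s 0 with rfl | hs
  · simp
  -- slope of `arctan` at `0` is `1`
  have hder : HasDerivAt Real.arctan 1 0 := by
    have := Real.hasDerivAt_arctan 0
    simpa using this
  have hslope : Tendsto (fun t : ℝ => t⁻¹ • (Real.arctan (0 + t) - Real.arctan 0)) (𝓝[≠] 0) (𝓝 1) :=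
    hasDerivAt_iff_tendsto_slope_zero.mp hder
  have ht : Tendsto (fun c : ℝ => s / c) atTop (𝓝[≠] 0) := by
    refine tendsto_nhdsWithin_iff.mpr ⟨?_, ?_⟩
    · simpa using tendsto_const_nhds.div_atTop tendsto_id
    · filter_upwards [eventually_gt_atTop 0] with c hc
      exact div_ne_zero hs hc.ne'
  have h2 := (hslope.comp ht).const_mul s
  rw [mul_one] at h2
  refine h2.congr' ?_
  filter_upwards [eventually_gt_atTop 0] with c hc
  simp only [comp_apply, zero_add, Real.arctan_zero, sub_zero, smul_eq_mul]
  field_simp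

/-- `c · arctan (s / c) → 0` as `c → 0⁺` (indeed `|c · arctan (s/c)| ≤ c π / 2`). [folklore] -/
theorem tendsto_mul_arctan_div_zero (s : ℝ) :
    Tendsto (fun c : ℝ => c * Real.arctan (s / c)) (𝓝[>] 0) (𝓝 0) := by
  have hb : ∀ c : ℝ, 0 < c → |c * Real.arctan (s / c)| ≤ c * (Real.pi / 2) := fun c hc =>
    ThinSetLiouville.abs_mul_arctan_div_le hc.le s
  have h0 : Tendsto (fun c : ℝ => c * (Real.pi / 2)) (𝓝[>] 0) (𝓝 0) := by
    have : Tendsto (fun c : ℝ => c * (Real.pi / 2)) (𝓝 0) (𝓝 (0 * (Real.pi / 2))) :=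
      tendsto_id.mul_const _
    rw [zero_mul] at this
    exact this.mono_left nhdsWithin_le_nhds
  refine squeeze_zero_norm' ?_ h0
  filter_upwards [self_mem_nhdsWithin] with c hc
  exact hb c hc


/-! ## Radial test functions built from a profile `ζ` on `(0, ∞)`

For a continuous `ζ : ℝ → ℝ` vanishing on `(-∞, a]` and on `[b, ∞)` (`0 < a ≤ b`) and a ratio
`L ≥ 1`, the kernel `k u = (ζ u - ζ (u / L)) / max u a` (`= (ζ u - ζ (u/L))/u` above `a`, `0`
below) has the compactly supported primitive `ρ τ = ∫_a^τ k` (the two halves have the same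
`du/u`-integral), and `x ↦ ρ (‖x‖²)` is a `C¹` compactly supported test function vanishing near
the origin with `⟪W, ∇ρ(‖x‖²)⟫ = 2 k(‖x‖²) ⟪W, x⟫`. No definitions are introduced: the kernel and
the primitive are written out, and the export is the existence statement `exists_radialTest`. -/

section Radial

variable {ζ : ℝ → ℝ} {a b L : ℝ}

/-- The kernel `k` is continuous (`max u a ≥ a > 0`). [folklore] -/
theorem continuous_kernel (hζ : Continuous ζ) (ha : 0 < a) (L : ℝ) :
    Continuous fun u : ℝ => (ζ u - ζ (u / L)) / max u a := by
  refine (hζ.sub (hζ.comp (continuous_id.div_const L))).div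
    (continuous_id.max continuous_const) fun u => ?_
  exact (lt_of_lt_of_le ha (le_max_right u a)).ne'

/-- Below `a` both `ζ u` and `ζ (u / L)` vanish. [folklore] -/
theorem sub_eq_zero_of_le (hL : 1 ≤ L) (ha : 0 < a) (hζa : ∀ u, u ≤ a → ζ u = 0) {u : ℝ}
    (hu : u ≤ a) : ζ u - ζ (u / L) = 0 := by
  have hL0 : 0 < L := lt_of_lt_of_le one_pos hL
  have h2 : u / L ≤ a := by
    rw [div_le_iff₀ hL0]
    calc u ≤ a := hu
      _ = a * 1 := (mul_one a).symm
      _ ≤ a * L := mul_le_mul_of_nonneg_left hL ha.le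
  rw [hζa u hu, hζa _ h2, sub_zero]

/-- The kernel vanishes on `(-∞, a]`. [folklore] -/
theorem kernel_eq_zero_of_le (hL : 1 ≤ L) (ha : 0 < a) (hζa : ∀ u, u ≤ a → ζ u = 0) {u : ℝ}
    (hu : u ≤ a) : (ζ u - ζ (u / L)) / max u a = 0 := by
  rw [sub_eq_zero_of_le hL ha hζa hu, zero_div]

/-- For every `u`: `k u = (ζ u - ζ (u/L)) / u` (both sides vanish below `a`). [folklore] -/
theorem kernel_eq_div (hL : 1 ≤ L) (ha : 0 < a) (hζa : ∀ u, u ≤ a → ζ u = 0) (u : ℝ) :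
    (ζ u - ζ (u / L)) / max u a = (ζ u - ζ (u / L)) / u := by
  rcases le_total a u with hu | hu
  · rw [max_eq_left hu]
  · rw [kernel_eq_zero_of_le hL ha hζa hu, sub_eq_zero_of_le hL ha hζa hu, zero_div]

/-- The kernel vanishes on `[L b, ∞)`. [folklore] -/
theorem kernel_eq_zero_of_ge (hL : 1 ≤ L) (hb : 0 ≤ b) (hζb : ∀ u, b ≤ u → ζ u = 0)
    {u : ℝ} (hu : L * b ≤ u) : (ζ u - ζ (u / L)) / max u a = 0 := by
  have hL0 : 0 < L := lt_of_lt_of_le one_pos hL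
  have h1 : b ≤ u := le_trans (by nlinarith) hu
  have h2 : b ≤ u / L := by rw [le_div_iff₀ hL0]; linarith
  rw [hζb u h1, hζb _ h2, sub_zero, zero_div]

/-- `ρ' = k` (fundamental theorem of calculus). [folklore] -/
theorem hasDerivAt_primitive (hζ : Continuous ζ) (ha : 0 < a) (L τ : ℝ) :
    HasDerivAt (fun τ => ∫ u in a..τ, (ζ u - ζ (u / L)) / max u a)
      ((ζ τ - ζ (τ / L)) / max τ a) τ :=
  intervalIntegral.integral_hasDerivAt_right ((continuous_kernel hζ ha L).intervalIntegrable _ _)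
    ((continuous_kernel hζ ha L).stronglyMeasurableAtFilter _ _)
    (continuous_kernel hζ ha L).continuousAt

/-- `ρ` is `C¹`. [folklore] -/
theorem contDiff_primitive (hζ : Continuous ζ) (ha : 0 < a) (L : ℝ) :
    ContDiff ℝ 1 fun τ => ∫ u in a..τ, (ζ u - ζ (u / L)) / max u a := by
  rw [contDiff_one_iff_deriv]
  refine ⟨fun τ => (hasDerivAt_primitive hζ ha L τ).differentiableAt, ?_⟩
  have : deriv (fun τ => ∫ u in a..τ, (ζ u - ζ (u / L)) / max u a) =
      fun τ => (ζ τ - ζ (τ / L)) / max τ a := funext fun τ => (hasDerivAt_primitive hζ ha L τ).deriv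
  rw [this]
  exact continuous_kernel hζ ha L

/-- `ρ` vanishes on `(-∞, a]`. [folklore] -/
theorem primitive_eq_zero_of_le (hL : 1 ≤ L) (ha : 0 < a) (hζa : ∀ u, u ≤ a → ζ u = 0) {τ : ℝ}
    (hτ : τ ≤ a) : ∫ u in a..τ, (ζ u - ζ (u / L)) / max u a = 0 := by
  rw [intervalIntegral.integral_congr (g := fun _ => (0 : ℝ)) fun u hu => ?_]
  · simp
  · rw [uIcc_of_ge hτ] at hu
    exact kernel_eq_zero_of_le hL ha hζa hu.2

/-- The total `du/u`-mass of `ζ` and of `ζ (·/L)` agree, so the primitive returns to `0`: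
`ρ (L b) = 0`. [folklore] -/
theorem primitive_apply_mul_eq_zero (hζ : Continuous ζ) (hL : 1 ≤ L) (ha : 0 < a) (hab : a ≤ b)
    (hζa : ∀ u, u ≤ a → ζ u = 0) (hζb : ∀ u, b ≤ u → ζ u = 0) :
    ∫ u in a..L * b, (ζ u - ζ (u / L)) / max u a = 0 := by
  have hL0 : 0 < L := lt_of_lt_of_le one_pos hL
  set g : ℝ → ℝ := fun v => ζ v / v with hg
  have hgc : ContinuousOn g (Ici a) := fun v hv =>
    (hζ.continuousAt.div continuousAt_id (lt_of_lt_of_le ha hv).ne').continuousWithinAt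
  have hgi : ∀ c d : ℝ, a ≤ c → a ≤ d → IntervalIntegrable g volume c d := fun c d hc hd =>
    (hgc.mono (by
      intro v hv
      rw [uIcc_comm] at hv
      rcases le_total c d with h | h
      · rw [uIcc_comm, uIcc_of_le h] at hv; exact le_trans hc hv.1
      · rw [uIcc_of_le h] at hv; exact le_trans hd hv.1)).intervalIntegrable
  -- on `[a, L b]` the kernel splits as `g u - g (u / L) / L`
  have hsplit : ∀ u ∈ uIcc a (L * b),
      (ζ u - ζ (u / L)) / max u a = g u - (fun v => g (v / L) / L) u := by
    intro u hu
    rw [uIcc_of_le (le_trans hab (by nlinarith))] at hu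
    have hu0 : u ≠ 0 := (lt_of_lt_of_le ha hu.1).ne'
    rw [max_eq_left hu.1, hg]
    simp only
    field_simp
  rw [intervalIntegral.integral_congr hsplit]
  have hgi2 : IntervalIntegrable (fun v => g (v / L) / L) volume a (L * b) := by
    refine ContinuousOn.intervalIntegrable ?_
    rw [uIcc_of_le (le_trans hab (by nlinarith))]
    intro v hv
    have hv0 : 0 < v / L := div_pos (lt_of_lt_of_le ha hv.1) hL0
    exact (((hζ.continuousAt.comp (continuousAt_id.div_const L)).div
      (continuousAt_id.div_const L) hv0.ne').div_const L).continuousWithinAt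
  rw [intervalIntegral.integral_sub (hgi a (L * b) le_rfl (le_trans hab (by nlinarith))) hgi2]
  -- second integral: substitution `v = u / L`
  have h2 : ∫ u in a..L * b, g (u / L) / L = ∫ v in a / L..b, g v := by
    rw [intervalIntegral.integral_div, intervalIntegral.integral_comp_div g hL0.ne',
      mul_div_cancel_left₀ b hL0.ne', smul_eq_mul]
    field_simp
  rw [h2]
  -- both equal `∫_a^b g`
  have haL : a / L ≤ a := div_le_self ha.le hL
  have h3 : ∫ v in a / L..b, g v = ∫ v in a..b, g v := by
    have hga : ∫ v in a / L..a, g v = 0 := by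
      rw [intervalIntegral.integral_congr (g := fun _ => (0 : ℝ)) fun v hv => ?_]
      · simp
      · rw [uIcc_of_le haL] at hv
        simp [hg, hζa v hv.2]
    have hgi' : IntervalIntegrable g volume (a / L) a := by
      refine (intervalIntegrable_iff.2 ?_)
      rw [uIoc_of_le haL]
      refine (integrableOn_congr_fun (fun v hv => ?_) measurableSet_Ioc).2 integrableOn_zero
      simp [hg, hζa v hv.2]
    rw [← intervalIntegral.integral_add_adjacent_intervals hgi' (hgi a b le_rfl hab), hga, zero_add]
  have h4 : ∫ v in a..L * b, g v = ∫ v in a..b, g v := by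
    have hgb : ∫ v in b..L * b, g v = 0 := by
      rw [intervalIntegral.integral_congr (g := fun _ => (0 : ℝ)) fun v hv => ?_]
      · simp
      · rw [uIcc_of_le (by nlinarith)] at hv
        simp [hg, hζb v hv.1]
    rw [← intervalIntegral.integral_add_adjacent_intervals (hgi a b le_rfl hab)
      (hgi b (L * b) hab (le_trans hab (by nlinarith))), hgb, add_zero]
  rw [h3, h4, sub_self]

/-- `ρ` vanishes on `[L b, ∞)`. [folklore] -/
theorem primitive_eq_zero_of_ge (hζ : Continuous ζ) (hL : 1 ≤ L) (ha : 0 < a) (hab : a ≤ b)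
    (hζa : ∀ u, u ≤ a → ζ u = 0) (hζb : ∀ u, b ≤ u → ζ u = 0) {τ : ℝ} (hτ : L * b ≤ τ) :
    ∫ u in a..τ, (ζ u - ζ (u / L)) / max u a = 0 := by
  have hb : 0 ≤ b := (lt_of_lt_of_le ha hab).le
  have hk := continuous_kernel hζ ha L
  rw [← intervalIntegral.integral_add_adjacent_intervals (b := L * b) (hk.intervalIntegrable _ _)
    (hk.intervalIntegrable _ _), primitive_apply_mul_eq_zero hζ hL ha hab hζa hζb, zero_add]
  rw [intervalIntegral.integral_congr (g := fun _ => (0 : ℝ)) fun u hu => ?_]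
  · simp
  · rw [uIcc_of_le hτ] at hu
    exact kernel_eq_zero_of_ge hL hb hζb hu.1

/-- **Radial test functions.** For a continuous profile `ζ` supported in `[a, b] ⊂ (0, ∞)` and a
ratio `L ≥ 1` there is a `C¹` compactly supported `θ : ℝ³ → ℝ`, vanishing near the origin, with
`⟪W x, ∇θ x⟫ = 2 (ζ(‖x‖²) − ζ(‖x‖²/L)) ‖x‖⁻² ⟪W x, x⟫` for every field `W` and point `x`
(namely `θ x = ρ(‖x‖²)` with `ρ` the primitive of the kernel above). [folklore] -/
theorem exists_radialTest (hζ : Continuous ζ) (hL : 1 ≤ L) (ha : 0 < a) (hab : a ≤ b)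
    (hζa : ∀ u, u ≤ a → ζ u = 0) (hζb : ∀ u, b ≤ u → ζ u = 0) :
    ∃ θ : EuclideanSpace ℝ (Fin 3) → ℝ, ContDiff ℝ 1 θ ∧ HasCompactSupport θ ∧
      (0 : EuclideanSpace ℝ (Fin 3)) ∉ tsupport θ ∧
      ∀ (W : EuclideanSpace ℝ (Fin 3) → EuclideanSpace ℝ (Fin 3)) (x : EuclideanSpace ℝ (Fin 3)),
        ⟪W x, gradient θ x⟫ = 2 * ((ζ (‖x‖ ^ 2) - ζ (‖x‖ ^ 2 / L)) / ‖x‖ ^ 2) * ⟪W x, x⟫ := by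
  set ρ : ℝ → ℝ := fun τ => ∫ u in a..τ, (ζ u - ζ (u / L)) / max u a with hρ
  refine ⟨fun x => ρ (‖x‖ ^ 2), (contDiff_primitive hζ ha L).comp (contDiff_norm_sq ℝ), ?_, ?_, ?_⟩
  · -- compact support inside `‖x‖² ≤ L b`
    have hLb : 0 ≤ L * b := mul_nonneg (zero_le_one.trans hL) (lt_of_lt_of_le ha hab).le
    refine HasCompactSupport.intro (isCompact_closedBall (0 : EuclideanSpace ℝ (Fin 3))
      (Real.sqrt (L * b))) fun x hx => ?_
    rw [mem_closedBall, dist_zero_right, not_le] at hx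
    refine primitive_eq_zero_of_ge hζ hL ha hab hζa hζb ?_
    have h0 : 0 ≤ Real.sqrt (L * b) := Real.sqrt_nonneg _
    calc L * b = Real.sqrt (L * b) ^ 2 := (Real.sq_sqrt hLb).symm
      _ ≤ ‖x‖ ^ 2 := by gcongr
  · -- vanishes near the origin
    rw [notMem_tsupport_iff_eventuallyEq]
    have hopen : IsOpen {x : EuclideanSpace ℝ (Fin 3) | ‖x‖ ^ 2 < a} :=
      isOpen_lt (continuous_norm.pow 2) continuous_const
    filter_upwards [hopen.mem_nhds (show (0 : EuclideanSpace ℝ (Fin 3)) ∈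
      {x : EuclideanSpace ℝ (Fin 3) | ‖x‖ ^ 2 < a} by simpa using ha)] with x hx
    exact primitive_eq_zero_of_le hL ha hζa (le_of_lt hx)
  · -- the gradient
    intro W x
    have hρ' : HasDerivAt ρ ((ζ (‖x‖ ^ 2) - ζ (‖x‖ ^ 2 / L)) / max (‖x‖ ^ 2) a) (‖x‖ ^ 2) :=
      hasDerivAt_primitive hζ ha L (‖x‖ ^ 2)
    have hd0 : HasFDerivAt (ρ ∘ fun y : EuclideanSpace ℝ (Fin 3) => ‖y‖ ^ 2)
        (((ζ (‖x‖ ^ 2) - ζ (‖x‖ ^ 2 / L)) / max (‖x‖ ^ 2) a) • (2 • innerSL ℝ x)) x :=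
      hρ'.comp_hasFDerivAt x (hasStrictFDerivAt_norm_sq x).hasFDerivAt
    have hd : HasFDerivAt (fun y : EuclideanSpace ℝ (Fin 3) => ρ (‖y‖ ^ 2))
        (((ζ (‖x‖ ^ 2) - ζ (‖x‖ ^ 2 / L)) / max (‖x‖ ^ 2) a) • (2 • innerSL ℝ x)) x := hd0
    rw [real_inner_comm, gradient, InnerProductSpace.toDual_symm_apply, hd.fderiv,
      kernel_eq_div hL ha hζa]
    simp only [_root_.smul_apply, innerSL_apply_apply, smul_eq_mul, nsmul_eq_mul, Nat.cast_ofNat,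
      real_inner_comm (W x)]
    ring

end Radial

end Summit.AnomalousDissipation.AnomalousDissipation.Theorems.PointFluxCone.Negative

end
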